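import Summits.ABC.IUTFork.Repair.RHQ3LTailUniformGalois
import HarnessLib

/-!
# D-0079 RESCUE sub-cell R-H, ROUND 2 Q3 — the existence input `HeavyGaloisData` of `RHQ3LTailUniform` (p481222) DISCHARGED
# (seat abc-iut-rh2-q3-typ-1 g3)

PROOF-ONLY file (D-0012; 0 definitions, 0 `Prop` facts, no instance, no notation). g2's `RHQ3LTailUniform` refuted the Galois-guarded uniform
l-tail reading `UniformLTailSigma8` modulo the displayed existence input `HeavyGaloisData` — «at arbitrarily large levels `l` there is a [IUTchI]
Def. 3.1 datum with `K/ℚ` Galois and one bad place HEAVY at `l`: `4·l·e(v|p)·(⌊log_p e_w⌋ + 2) + 2 ≤ (l−3)·ord_v(q_v)`» — honestly flagged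
«NOT constructed in the tree». The companion `RHQ3LTailUniformGalois` (p493238) proved `¬ UniformLTailSigma8` directly; THIS FILE also
discharges the named input itself: **`heavyGaloisData_holds : HeavyGaloisData`** (so `not_uniformLTailSigma8_of_heavyGaloisData heavyGaloisData_holds`
is a second, definitionally different proof term of the already-landed `not_uniformLTailSigma8`; not restated). Witness as in the companions: prime `l ≡ 3 (mod 4)`, `l > max(l₀, 160)`; prime
`r ∈ (30l, 60l]`; `λ_r = r⁸/(r⁸+1)`; the genuine Θ-volume datum of `UniformWitness.exists_thetaVolumeDatumAt_isGalois` (`K = F‡(λ_r)(E[l])`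
Galois over `ℚ`); at the bad place `x₀ ∣ r` of abc-iut-c312-7's `GenuineK.exists_bad_tame_place_of_ord_neg`: `ord_v(q_v) = 16·e(v|r)`
([IUTchI] Def. 3.1 (b)) and `e_{x₀} ∣ 30·l < r` (abc-iut-W-neg-1's `ramificationIdx_int_dvd_thirty_mul_ratPoint'`), so `⌊log_r e_{x₀}⌋ = 0` and the
heavy inequality reads `8·l·e + 2 ≤ 16·(l−3)·e` (`l ≥ 7`) — §1 `exists_heavy_place_ratPoint_of_pole` is the place-level form of
`UniformWitness.not_inSigma8_ratPoint_of_pole` (p489180) with the two identities exposed.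
Nothing here asserts abc or takes a side on [IUTchIII] Cor. 3.12 or on any author; the Θ-data are the tree's interface inhabitants as in every
R-W refutation of record; typed ≠ proved.
[cite: Mochizuki2012, IUTchI Def. 3.1 (b)(c) pp. 61–62, Ex. 3.2 (iv) p. 71; IUTchIV Prop. 1.2 (i)(ii) p. 10, Thm. 1.10 Steps (ii)–(iii) pp. 24–26,
Cor. 2.2 (ii) proof (P7) p. 46] [cite: SerreLocalFields1979, Ch. IV §2 Cor. 1 of Prop. 7] [claim: Mochizuki2012, status: disputed] for every IUT locution.
-/

noncomputable section

open Set Function NumberField IsDedekindDomain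

namespace Summit.ABC.IUTFork.Repair.RH.Q3LTailSigma8

open Literature.IUT.LogThetaLattice Literature.IUT.LogVolume Literature.IUT.HodgeTheaters
open Literature.IUT.LogVolume.ThetaData Literature.IUT.LogVolume.Cor22
open Summit.ABC.IUTFork.Thm311 Summit.ABC.IUTFork.Thm311.Real Summit.ABC.IUTFork.Cor312Prov
open Literature.NumberTheory.NumberFields Literature.NumberTheory.DiophantineGeometry
  Literature.NumberTheory.DiophantineGeometry.GenEll Literature.NumberTheory.DiophantineGeometry.UniformABCConjecture
  Rat.HeightOneSpectrum Summit.ABC.ABC.Theorems Summit.ABC.IUTFork.Conditional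

namespace UniformWitness

/-! ## §1. The heavy bad place at a rational point with a large pole prime (place-level form of `not_inSigma8_ratPoint_of_pole`) -/

/-- **A BAD, SHALLOWLY RAMIFIED, DEEP place.** `λ ∈ ℚ`, `T` a genuine Θ-volume datum at `(ratPoint λ, l)` (`l` prime), `p ∉ {2, 3, 5, l}` a prime at
which `j(λ)` has a pole of exact order `h ≥ 1`: there is a place `x₀ ∣ p` of the `K`-level pilot datum which is BAD (`∈ S`), with
`e(x₀|p) ≤ 30·l` (abc-iut-W-neg-1) and `ord_v(q_v) = e(v|p)·h` at the place `v` of `F` under it ([IUTchI] Def. 3.1 (b): multiplicative).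
[cite: Mochizuki2012, IUTchI Def. 3.1 (b)(c) pp. 61–62; IUTchIV Thm. 1.10 Steps (ii)–(iii) pp. 24–26] [cite: SerreLocalFields1979, Ch. IV §2 Cor. 1 of Prop. 7]
[claim: Mochizuki2012, status: disputed] -/
theorem exists_heavy_place_ratPoint_of_pole {q : ℚ} {l : ℕ} (T : ThetaVolumeDatumAt (ratPoint q) l) (hP : ratPoint q ∈ UP) (hl : l.Prime)
    (pp : Nat.Primes) (hp2 : (pp : ℕ) ≠ 2) (hp3 : (pp : ℕ) ≠ 3) (hp5 : (pp : ℕ) ≠ 5) (hpl : (pp : ℕ) ≠ l)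
    {h : ℕ} (hh : 0 < h) (hord : ∀ u : HeightOneSpectrum (𝓞 ℚ), natGenerator u = (pp : ℕ) → ord ℚ u (jInv q) = -(h : ℤ)) :
    letI := T.instFieldF; letI := T.instNumberFieldF; letI := T.instAlgebraF; letI := T.instFieldK
    letI := T.instNumberFieldK; letI := T.instAlgebraK; letI := T.instFieldFbar; letI := T.instAlgebraFbar
    letI := T.instAlgebraKFbar; letI := T.instIsElliptic
    haveI : Fact (pp : ℕ).Prime := ⟨pp.2⟩
    ∃ x₀ : (thetaIndex (pilotDataOfK T.D T.K)).Fibre (.inr pp),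
      placeOf (pilotDataOfK T.D T.K) pp.1 x₀ ∈ (pilotDataOfK T.D T.K).S ∧
      ramIdx T.K (placeOf (pilotDataOfK T.D T.K) pp.1 x₀) ≤ 30 * l ∧
      qParamOrd T.E (finBelow T.F T.K (placeOf (pilotDataOfK T.D T.K) pp.1 x₀)) =
        ramIdx T.F (finBelow T.F T.K (placeOf (pilotDataOfK T.D T.K) pp.1 x₀)) * h := by
  letI := T.instFieldF; letI := T.instNumberFieldF; letI := T.instAlgebraF; letI := T.instFieldK
  letI := T.instNumberFieldK; letI := T.instAlgebraK; letI := T.instFieldFbar; letI := T.instAlgebraFbar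
  letI := T.instAlgebraKFbar; letI := T.instIsElliptic
  haveI : Fact (pp : ℕ).Prime := ⟨pp.2⟩
  -- the place `v₀` of `ℚ` over `p`: pole of order `h`, `e(v₀|p) = 1`
  set v₀ : HeightOneSpectrum (𝓞 ℚ) := (primesEquiv (R := 𝓞 ℚ)).symm ⟨pp.1, pp.2⟩ with hv₀def
  have hgen : natGenerator v₀ = (pp : ℕ) := natGenerator_primesEquiv_symm pp.1 pp.2
  have hv₀ : ((pp : ℕ) : 𝓞 ℚ) ∈ v₀.asIdeal := FreyP6Engine.natCast_mem_asIdeal pp.1 pp.2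
  have hram₀ : ramIdx ℚ v₀ = 1 := by
    rw [ramIdx_eq]; exact Literature.NumberTheory.EllipticCurves.Fisher2016.ramificationIdx_int_rat_eq_one v₀
  have hv₀e : ¬ (pp : ℕ) ∣ ramIdx ℚ v₀ := by rw [hram₀]; exact pp.2.not_dvd_one
  have hm : ord ℚ v₀ (jInv q) = -(h : ℤ) := hord v₀ hgen
  obtain ⟨x₀, hx₀S, -, -, -⟩ := GenuineK.exists_bad_tame_place_of_ord_neg T hP hl pp hp2 hp3 hp5 hpl v₀ hv₀ hv₀e hm hh
  refine ⟨x₀, hx₀S, ?_, ?_⟩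
  · -- `e_{x₀} ∣ 30·l`
    have hpole : ∀ u : HeightOneSpectrum (𝓞 ℚ), natGenerator u = (pp : ℕ) → ord ℚ u (jInv q) < 0 := by
      intro u hu; rw [hord u hu]
      have : (0 : ℤ) < h := by exact_mod_cast hh
      linarith
    have hnot : (pp : ℕ) ∉ ({2, 3, 5, l} : Finset ℕ) := by
      simp only [Finset.mem_insert, Finset.mem_singleton, not_or]
      exact ⟨hp2, hp3, hp5, hpl⟩
    have hwchar : residueChar T.K (placeOf (pilotDataOfK T.D T.K) pp.1 x₀) = (pp : ℕ) :=
      residueChar_eq_of_natCast_mem pp.1 (natCast_mem_placeOf (pilotDataOfK T.D T.K) pp.1 x₀)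
    rw [ramIdx_eq]
    exact Nat.le_of_dvd (by have := hl.two_le; omega)
      (T.ramificationIdx_int_dvd_thirty_mul_ratPoint' hnot hpole (placeOf (pilotDataOfK T.D T.K) pp.1 x₀) hwchar)
  · -- `ord_v(q_v) = e(v|p)·h`
    set w := placeOf (pilotDataOfK T.D T.K) pp.1 x₀ with hwdef
    set v := finBelow T.F T.K w with hvdef
    set u₀ := finBelow (ratPoint q).F T.F v with hu₀def
    have hw_under : w.under (𝓞 T.F) = v := rfl
    have hv_under : v.under (𝓞 (ratPoint q).F) = u₀ := rfl
    obtain ⟨u₁, hu₁⟩ : ∃ u₁ : HeightOneSpectrum (𝓞 ℚ), u₁ = finBelow (ratPoint q).F T.F v := ⟨_, rfl⟩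
    have hu₁gen : natGenerator u₁ = (pp : ℕ) :=
      GenuineK.natGenerator_eq_of_eq_finBelow_placeOf T pp x₀ u₁ (by rw [hu₁, hvdef, hwdef])
    have hordu₀ : Literature.IUT.LogVolume.ord (ratPoint q).F (finBelow (ratPoint q).F T.F v) (jInv (ratPoint q).x) = -(h : ℤ) := by
      have := hord u₁ hu₁gen
      rw [hu₁] at this
      exact this
    have hvVFbad : FinitePlace.mk v ∈ T.D.VFbad := (mem_pilotDataOfK_S_iff T.D T.K w).mp hx₀S
    have hq : (qParamOrd T.E v : ℤ) = (Ideal.ramificationIdx' u₀.asIdeal v.asIdeal : ℤ) * h := by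
      have h1 := ThetaData.neg_ord_j_eq_ramificationIdx_mul_qParamOrd_of_under_mem_VFbad T.D (w := w)
        (by rw [hw_under]; exact hvVFbad)
      rw [hw_under] at h1
      have h2 : Literature.IUT.LogVolume.ord T.K w (algebraMap T.F T.K T.E.j) =
          (Ideal.ramificationIdx' v.asIdeal w.asIdeal : ℤ) * ((Ideal.ramificationIdx' u₀.asIdeal v.asIdeal : ℤ) * (-(h : ℤ))) := by
        rw [Cor22.ord_algebraMap_eq w, T.j_eq, Cor22.ord_algebraMap_eq v, hordu₀]
      rw [h2] at h1
      have hne : (Ideal.ramificationIdx' v.asIdeal w.asIdeal : ℤ) ≠ 0 := by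
        exact_mod_cast Ideal.IsDedekindDomain.ramificationIdx'_ne_zero_of_liesOver w.asIdeal v.ne_bot
      have h3 : (Ideal.ramificationIdx' v.asIdeal w.asIdeal : ℤ) * (qParamOrd T.E v : ℤ) =
          (Ideal.ramificationIdx' v.asIdeal w.asIdeal : ℤ) * ((Ideal.ramificationIdx' u₀.asIdeal v.asIdeal : ℤ) * h) := by
        linarith
      exact mul_left_cancel₀ hne h3
    have hq' : qParamOrd T.E v = Ideal.ramificationIdx' u₀.asIdeal v.asIdeal * h := by exact_mod_cast hq
    have hramu₀ : ramIdx (ratPoint q).F u₀ = 1 := by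
      rw [ramIdx_eq]; exact Literature.NumberTheory.EllipticCurves.Fisher2016.ramificationIdx_int_rat_eq_one u₀
    have hramv : ramIdx T.F v = Ideal.ramificationIdx' u₀.asIdeal v.asIdeal := by
      rw [ramIdx_eq, ThetaData.absRamificationIdx_eq_ramIdx_mul (F := (ratPoint q).F) v, hv_under, hramu₀, one_mul]
    rw [hramv, hq']

/-! ## §2. `HeavyGaloisData` holds -/

/-- **THE EXISTENCE INPUT OF p481222 IS A THEOREM: `HeavyGaloisData`.** For every `l₀`: the prime `l ≡ 3 (mod 4)`, `l > max(l₀, 160)`, the prime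
`r ∈ (30l, 60l]`, the curve `E_{λ_r} ⊗ F‡(λ_r)`, `λ_r = r⁸/(r⁸+1)`, over `F‡(λ_r)`, the genuine datum of `exists_thetaVolumeDatumAt_isGalois` (`K/ℚ` Galois)
and its bad place over `r` (§1: `e_{x₀} ≤ 30·l < r`, so `⌊log_r e_{x₀}⌋ = 0`; `ord_v(q_v) = 16·e(v|r)`; `8·l·e + 2 ≤ 16·(l−3)·e`).
[cite: Mochizuki2012, IUTchI Def. 3.1 (b)(c) pp. 61–62; IUTchIV Prop. 1.2 (i)(ii) p. 10, Cor. 2.2 (ii) proof (P7) p. 46] [claim: Mochizuki2012, status: disputed] -/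
theorem heavyGaloisData_holds : HeavyGaloisData := by
  intro l₀
  obtain ⟨l, hlgt, hl, hmod⟩ := Nat.forall_exists_prime_gt_and_modEq (max l₀ 160) (q := 4) (a := 3) (by norm_num) (by norm_num)
  have hl0 : l₀ ≤ l := le_trans (le_max_left _ _) hlgt.le
  have hl160 : 160 ≤ l := le_trans (le_max_right _ _) hlgt.le
  have hmod' : l % 4 = 3 := hmod
  obtain ⟨r, hr, h30, h60⟩ := Nat.exists_prime_lt_and_le_two_mul (30 * l) (by omega)
  have hr2 : r ≠ 2 := by omega
  have hr5 : r ≠ 5 := by omega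
  have hrl : r ≠ l := by omega
  have h3l : r ^ 8 + 1 < 3 ^ l := pow_eight_succ_lt_three_pow hl160 (by omega)
  obtain ⟨T, hGal⟩ := exists_thetaVolumeDatumAt_isGalois (mem_UP r hr.pos) hl (by omega) (admitsCore r hr (by omega))
    (condP2 r hr hr2 hl (by omega) h3l) (condP5 r hr hr2 hl hrl) (condP6 r hr hr2 hr5 hl (by omega) hmod' hrl)
  letI := T.instFieldF; letI := T.instNumberFieldF; letI := T.instAlgebraF; letI := T.instFieldK
  letI := T.instNumberFieldK; letI := T.instAlgebraK; letI := T.instFieldFbar; letI := T.instAlgebraFbar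
  letI := T.instAlgebraKFbar; letI := T.instIsElliptic
  set pp : Nat.Primes := ⟨r, hr⟩ with hpp
  haveI : Fact (pp : ℕ).Prime := ⟨pp.2⟩
  obtain ⟨x₀, hx₀S, hB, hq⟩ := exists_heavy_place_ratPoint_of_pole T (mem_UP r hr.pos) hl pp
    (by change r ≠ 2; omega) (by change r ≠ 3; omega) (by change r ≠ 5; omega) (by change r ≠ l; omega) (h := 16) (by norm_num)
    (fun u hu => by rw [ord_jInv_of_natGenerator_eq r hr hr2 u hu]; norm_num)
  refine ⟨l, hl0, T.F, T.instFieldF, T.instNumberFieldF, T.E, T.instIsElliptic, T.K, T.Fbar, T.instFieldK, T.instNumberFieldK,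
    T.instAlgebraK, T.instFieldFbar, T.instAlgebraFbar, T.instAlgebraKFbar, T.Pb, T.D, hGal, pp, x₀, hx₀S, ?_⟩
  -- `⌊log_r e_{x₀}⌋ = 0` and the arithmetic `8·l·e + 2 ≤ 16·(l−3)·e`
  have hlog : Nat.log (pp : ℕ) (ramIdx T.K (placeOf (pilotDataOfK T.D T.K) pp.1 x₀)) = 0 :=
    Nat.log_eq_zero_iff.2 (Or.inl (lt_of_le_of_lt hB h30))
  rw [hlog, hq]
  set e := ramIdx T.F (finBelow T.F T.K (placeOf (pilotDataOfK T.D T.K) pp.1 x₀)) with hedef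
  have he1 : 1 ≤ e := Nat.one_le_iff_ne_zero.2 (ramIdx_ne_zero T.F _)
  obtain ⟨m, rfl⟩ := Nat.exists_eq_add_of_le (show 7 ≤ l by omega)
  have h73 : 7 + m - 3 = 4 + m := by omega
  rw [h73]
  nlinarith [he1, Nat.zero_le (m * e)]

end UniformWitness

end Summit.ABC.IUTFork.Repair.RH.Q3LTailSigma8

end
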